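import Literature.NumberTheory.GaloisRepresentations.IdeleSUnitsClassSequenceInflationDelta
import Literature.NumberTheory.GaloisRepresentations.RestrictedRamificationCycCapLayers
import Literature.NumberTheory.GaloisRepresentations.SUnitsLayerBridgeTransport
import HarnessLib

/-!
# INJECTIVITY SUPPLY in degree `2`: a class of `H²(Gal(E/F₀), 𝒪ˣ_{E,S})` that dies in `H²(Gal(E/F₀), J_{E,S})` dies in a
# bigger layer of `K_S` (Neukirch–Schmidt–Wingberg (8.3.11) (ii)/(iii): `H²(G_S, 𝒪_S^×) ↪ H²(G_S, I_S)` — the finite-layer statement)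

Topic `NumberTheory/GaloisRepresentations`; namespaces `Literature.NumberTheory.GaloisRepresentations.IdeleCohomology` (§1, one
tower of number fields) and `Literature.NumberTheory.GaloisRepresentations` (§2, layers of `K_S`).  THEOREMS ONLY (no definition,
no named fact, no `sorry`, no instance).  Lane «TATE-EPC-TC» of cell `bsd-eis` (crux `GoodLatticeBDPValue`,
stmt-BirchSwinnertonDyer-19032; brick B6a, layer half): the finite-layer input of «`H²(G_{K,S}, 𝒪_S^×)(p) ≅ ker(⊕_{v∈S} ℚ_p/ℤ_p → ℚ_p/ℤ_p)`»,
i.e. of the EXACT structure of `H²(G_S, 𝒪_S^×)` (NSW (8.3.11) (ii)/(iii)), complementing the SUPPLY statement of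
`RestrictedRamificationSUnitsLayerSupplyTwo` (`p`-divisibility, (8.3.11) (iii)).

MATHEMATICS (NSW VIII §3, proof of (8.3.11); Harari §17.4, Prop. 15.40 (a)).  Let `F ⊆ E ⊆ E'` be finite Galois extensions of
number fields and `S` a finite set of finite places of `F`, and suppose every idèle of `E` lies in `E'ˣ · J_{E',S}` after base
change (CAPITULATION; for the layers of `K_S` this is the principal ideal theorem, `lim→ Cl_S = 0`).  With `G = Gal(E/F)` and
the exact sequences (A) `0 → 𝒪ˣ_{E,S} → J_{E,S} → J_{E,S}Eˣ/Eˣ → 0`, (B) `0 → J_{E,S}Eˣ/Eˣ → C_E → Cl_S(E) → 0`: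
a class `x ∈ H²(G, 𝒪ˣ_{E,S})` with `ι_* x = 0 ∈ H²(G, J_{E,S})` is `x = δ_A t`, `t ∈ H¹(G, J_{E,S}Eˣ/Eˣ)` (exactness of (A)),
and `t = δ_B s`, `s ∈ H⁰(G, Cl_S(E))`, because `H¹(G, C_E) = 0` (class field theory) makes `δ_B : H⁰(Cl_S) ↠ H¹(J_SEˣ/Eˣ)` onto.
Inflation commutes with both connecting maps (the morphisms of short exact sequences (A), (B) over `res : Gal(E'/F) ↠ G` of
`IdeleSUnitsClassSequenceInflationDelta`), and `Inf = 0` on `H⁰(·, Cl_S)` by capitulation; hence `Inf x = δ_A' δ_B' (Inf s) = 0`.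
§2 places this in the lane's currency: `K` a number field, `S` a set of finite places of `K` with `S` finite, `F₀ ≤ E ⊆ K_S = K̄^{N_S}`
intermediate fields with `E/K` finite Galois, `S₀` the places of `F₀` above `S`, the `S`-UNIT MODEL `SUnits.sUnitsRep K S F₀ E` and
its map `sUnitsToIdeleS` to `J_{E,S₀}` (this seat's `SUnitsIdeleBridge`): if `c ∈ H²(Gal(E/F₀), 𝒪ˣ_{E,S})` dies in
`H²(Gal(E/F₀), J_{E,S₀})`, then `Inf c = 0` in `H²(Gal(E'/F₀), 𝒪ˣ_{E',S})` for the capitulating layer `E' ⊇ E` of `K_S`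
(`RestrictedRamificationCycCapLayers.exists_capitulationLayer_sup_ideleS`, width seat w6's principal ideal theorem placement),
transported through `Hⁿ(bridge)` (`sUnitsRepInf_comp_map_sUnitsBridge`, injective by w2's `SUnits.Layers.map_sUnitsBridge_injective`).

* §1 `IdeleCohomology.exists_δ_sUnits_one_eq` (exactness of (A) at `H²(𝒪ˣ_S)`), `IdeleCohomology.exists_δ_δ_eq_of_map_sUnitsIdeleι_two_eq_zero`
  (`x = δ_A δ_B s`), **`IdeleCohomology.sUnitsIdeleInf_two_eq_zero_of_map_eq_zero`** (capitulation ⟹ `Inf x = 0`).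
* §2 **`exists_layerInf_two_eq_zero_of_map_sUnitsToIdeleS_eq_zero`** — the INJECTIVITY SUPPLY statement over `K_S` in the
  `SUnits.Layers.layerInf` currency.

HONEST FRAMING: finite-layer statements only (no colimit, no `G_S`-module, no `Nat.card`); proves neither (8.3.11) (ii) for `G_S` nor
any statement of a Summit; no case of BSD is advanced by this file alone; 0 cells / labels / tiers move.

## References
* J. Neukirch, A. Schmidt, K. Wingberg, *Cohomology of Number Fields*, 2nd ed. (2008), VIII §3, (8.3.11) (ii)/(iii) and its proof
  («`Cl_S(k_S) = 0`», «`H¹(G_S, C_S) = 0`»). [NeukirchSchmidtWingberg2008]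
* D. Harari, *Galois Cohomology and Class Field Theory*, Universitext, Springer (2020), §17.4 (17.1), Prop. 15.40 (a), Lemma 15.39.
  [Harari2020]
* J. W. S. Cassels, A. Fröhlich (eds.), *Algebraic Number Theory* (1967), Ch. VII (J. Tate) §11.1. [CasselsFrohlichANT1967]
-/

noncomputable section

open NumberField IsDedekindDomain Field IntermediateField CategoryTheory groupCohomology
open Literature.NumberTheory.GaloisRepresentations.OpenSubgroupLayer (algOfLE isScalarTower_algOfLE)
open Literature.NumberTheory.GaloisRepresentations.LocalWeilDatum
open Literature.NumberTheory.Automorphic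

namespace Literature.NumberTheory.GaloisRepresentations

/-! ## §1. One tower `F ⊆ E ⊆ E'`: capitulation kills the classes of `H²(G, 𝒪ˣ_{E,S})` that die in `H²(G, J_{E,S})` -/

namespace IdeleCohomology

variable {F E E' : Type} [Field F] [NumberField F] [Field E] [NumberField E] [Field E'] [NumberField E']
  [Algebra F E] [Algebra E E'] [Algebra F E'] [IsScalarTower F E E'] [IsGalois F E]
variable (S : Finset (HeightOneSpectrum (𝓞 F)))

omit [IsGalois F E] in
/-- **Exactness at `H²(G, 𝒪ˣ_{E,S})` of (A)**: a class of `H²(G, 𝒪ˣ_{E,S})` dying in `H²(G, J_{E,S})` is the connecting image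
of a class of `H¹(G, J_{E,S}Eˣ/Eˣ)` (element form of Mathlib's `mapShortComplex₁_exact`).
[cite: NeukirchSchmidtWingberg2008, VIII §3 (8.3.11) (proof)] -/
theorem exists_δ_sUnits_one_eq (x : groupCohomology (sUnitsIdeleRep F E S) 2)
    (hx : groupCohomology.map (MonoidHom.id _) (sUnitsIdeleι S) 2 x = 0) :
    ∃ t : groupCohomology (ideleSClassRep F E S) 1,
      groupCohomology.δ (sUnitsShortComplex_shortExact (F := F) (E := E) S) 1 2 rfl t = x := by
  have h := (mapShortComplex₁_exact (sUnitsShortComplex_shortExact (F := F) (E := E) S)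
    (i := 1) (j := 2) rfl).moduleCat_range_eq_ker
  have hx' : x ∈ LinearMap.ker (mapShortComplex₁ (sUnitsShortComplex_shortExact (F := F) (E := E) S)
      (i := 1) (j := 2) rfl).g.hom := hx
  rw [← h] at hx'
  exact hx'

/-- **`x = δ_A δ_B s` with `s ∈ H⁰(G, Cl_S(E))`** for every `x ∈ H²(G, 𝒪ˣ_{E,S})` dying in `H²(G, J_{E,S})` (`E/F` Galois):
exactness of (A), then `δ_B : H⁰(G, Cl_S(E)) ↠ H¹(G, J_{E,S}Eˣ/Eˣ)` is onto because `H¹(G, C_E) = 0` (`epi_δ_sClass_zero`).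
[cite: NeukirchSchmidtWingberg2008, VIII §3 (8.3.11) (proof: `H¹(G_S, C_S) = 0`)][cite: Harari2020, §17.4 (17.1)] -/
theorem exists_δ_δ_eq_of_map_sUnitsIdeleι_two_eq_zero (x : groupCohomology (sUnitsIdeleRep F E S) 2)
    (hx : groupCohomology.map (MonoidHom.id _) (sUnitsIdeleι S) 2 x = 0) :
    ∃ s : groupCohomology (sClassGroupRep F E S) 0,
      groupCohomology.δ (sUnitsShortComplex_shortExact (F := F) (E := E) S) 1 2 rfl
        (groupCohomology.δ (sClassShortComplex_shortExact (F := F) (E := E) S) 0 1 rfl s) = x := by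
  obtain ⟨t, rfl⟩ := exists_δ_sUnits_one_eq S x hx
  obtain ⟨s, hs⟩ := (ModuleCat.epi_iff_surjective _).1 (epi_δ_sClass_zero (F := F) (E := E) S) t
  exact ⟨s, congrArg (fun y => groupCohomology.δ (sUnitsShortComplex_shortExact (F := F) (E := E) S) 1 2 rfl y) hs⟩

/-- **INJECTIVITY SUPPLY, one tower (NSW (8.3.11) (ii)/(iii) proof, finite layers).**  `F ⊆ E ⊆ E'` number fields, `E/F` Galois,
`S` a finite set of finite places of `F`; assume CAPITULATION: the base change of every idèle of `E` lies in `E'ˣ · J_{E',S}`.  Then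
every `x ∈ H²(Gal(E/F), 𝒪ˣ_{E,S})` whose image in `H²(Gal(E/F), J_{E,S})` vanishes satisfies `Inf x = 0` in
`H²(Gal(E'/F), 𝒪ˣ_{E',S})`: `x = δ_A δ_B s`, `Inf` commutes with `δ_A`, `δ_B` (`sUnitsIdeleInf_δ_apply`, `ideleSClassInf_δ_apply`)
and `Inf s = 0` on `H⁰(·, Cl_S)` (`sClassGroupInf_eq_zero_of_forall_mem_sup`).
[cite: NeukirchSchmidtWingberg2008, VIII §3 (8.3.11) (ii)/(iii) (proof)][cite: Harari2020, §17.4 (17.1), Prop. 15.40 (a)] -/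
theorem sUnitsIdeleInf_two_eq_zero_of_map_eq_zero
    (hcap : ∀ a : ideleGroup E, AdeleRing.ideleBaseChange E E' a ∈ principalIdeles E' ⊔ ideleS F E' S)
    (x : groupCohomology (sUnitsIdeleRep F E S) 2)
    (hx : groupCohomology.map (MonoidHom.id _) (sUnitsIdeleι S) 2 x = 0) :
    sUnitsIdeleInf F E E' S 2 x = 0 := by
  obtain ⟨s, rfl⟩ := exists_δ_δ_eq_of_map_sUnitsIdeleι_two_eq_zero S x hx
  rw [sUnitsIdeleInf_δ_apply S 1 2 rfl, ideleSClassInf_δ_apply S 0 1 rfl, sClassGroupInf_eq_zero_of_forall_mem_sup S hcap 0]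
  simp only [ModuleCat.hom_zero, LinearMap.zero_apply]
  -- `δ_A' (δ_B' 0) = 0`
  have h1 : (groupCohomology.δ (sClassShortComplex_shortExact (F := F) (E := E') S) 0 1 rfl)
      (0 : groupCohomology (sClassGroupRep F E' S) 0) = 0 := map_zero _
  have h2 : (groupCohomology.δ (sUnitsShortComplex_shortExact (F := F) (E := E') S) 1 2 rfl)
      (0 : groupCohomology (ideleSClassRep F E' S) 1) = 0 := map_zero _
  exact (congrArg (fun y => (groupCohomology.δ (sUnitsShortComplex_shortExact (F := F) (E := E') S) 1 2 rfl) y) h1).trans h2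

end IdeleCohomology

/-! ## §2. Over `K_S`: the injectivity supply statement in the `SUnits.Layers.layerInf` currency -/

variable {K : Type} [Field K] [NumberField K] (S : Set (HeightOneSpectrum (𝓞 K)))

/-- **INJECTIVITY SUPPLY, degree `2` (NSW (8.3.11) (ii)/(iii) at finite layers, `S`-unit model).**  `K` a number field, `S` a set of
finite places of `K`, `F₀ ≤ E ⊆ K_S` with `E/K` finite Galois, `S₀` the finite set of places of `F₀` above `S`.  For every
`c ∈ H²(Gal(E/F₀), 𝒪ˣ_{E,S})` whose image in `H²(Gal(E/F₀), J_{E,S₀})` (under `𝒪ˣ_{E,S} → J_{E,S₀}`, this seat's `sUnitsToIdeleS`)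
vanishes, there is a finite Galois layer `E′ ⊇ E` inside `K_S` with `Inf c = 0` in `H²(Gal(E′/F₀), 𝒪ˣ_{E′,S})` (all algebras =
inclusions).  `E′ :=` the capitulating layer of `exists_capitulationLayer_sup_ideleS`; the vanishing is
`IdeleCohomology.sUnitsIdeleInf_two_eq_zero_of_map_eq_zero` for the principal `S₀`-idèles, transported to `SUnits.sUnitsRep`
through the bridge square `IdeleCohomology.sUnitsRepInf_comp_map_sUnitsBridge` and the injectivity of `H²(bridge_{E′})`
(`SUnits.Layers.map_sUnitsBridge_injective`).
[cite: NeukirchSchmidtWingberg2008, VIII §3 (8.3.11) (ii)/(iii) (proof)][cite: Harari2020, §17.4 (17.1), Prop. 15.40 (a)] -/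
theorem exists_layerInf_two_eq_zero_of_map_sUnitsToIdeleS_eq_zero
    {F₀ E : IntermediateField K (AlgebraicClosure K)} [FiniteDimensional K E] [IsGalois K E] (hF : F₀ ≤ E)
    (hS : ramificationSubgroup K S ≤ galFixing K E)
    (S₀ : Finset (HeightOneSpectrum (𝓞 F₀))) (hSF : ∀ u : HeightOneSpectrum (𝓞 F₀), u ∈ S₀ ↔ u.under (𝓞 K) ∈ S)
    (c : letI := algOfLE hF; groupCohomology (SUnits.sUnitsRep K S F₀ E) 2)
    (hc : letI := algOfLE hF
      haveI : FiniteDimensional K F₀ :=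
        FiniteDimensional.of_injective (IntermediateField.inclusion hF).toLinearMap (IntermediateField.inclusion hF).injective
      haveI : NumberField F₀ := NumberField.of_module_finite K F₀
      haveI : NumberField E := NumberField.of_module_finite K E
      haveI := isScalarTower_algOfLE (K := K) hF
      groupCohomology.map (MonoidHom.id _) (IdeleCohomology.sUnitsToIdeleS (K := K) (F := F₀) (E := E) S S₀ hSF) 2 c = 0) :
    ∃ (E' : IntermediateField K (AlgebraicClosure K)) (_ : FiniteDimensional K E') (_ : IsGalois K E') (hEE' : E ≤ E')
      (_ : ramificationSubgroup K S ≤ galFixing K E'),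
      SUnits.Layers.layerInf S hF hEE' 2 c = 0 := by
  classical
  -- the base `F₀` and the layer `E` over it
  letI := algOfLE hF
  haveI := isScalarTower_algOfLE (K := K) hF
  haveI : FiniteDimensional K F₀ :=
    FiniteDimensional.of_injective (IntermediateField.inclusion hF).toLinearMap (IntermediateField.inclusion hF).injective
  haveI : NumberField F₀ := NumberField.of_module_finite K F₀
  haveI : NumberField E := NumberField.of_module_finite K E
  haveI : IsGalois F₀ E := IsGalois.tower_top_of_isGalois K F₀ E
  -- the capitulating layer `E ≤ E₂ ⊆ K_S`
  obtain ⟨E₂, h₂, hfin₂, hgal₂, hS₂, hcap⟩ := exists_capitulationLayer_sup_ideleS S hF hS S₀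
  refine ⟨E₂, hfin₂, hgal₂, h₂, hS₂, ?_⟩
  letI := algOfLE h₂
  letI := algOfLE (hF.trans h₂)
  haveI : NumberField E₂ := NumberField.of_module_finite K E₂
  haveI := isScalarTower_algOfLE (K := K) h₂
  haveI := isScalarTower_algOfLE (K := K) (hF.trans h₂)
  haveI : IsScalarTower F₀ E E₂ := IsScalarTower.of_algebraMap_eq fun _ => rfl
  haveI : IsGalois F₀ E₂ := IsGalois.tower_top_of_isGalois K F₀ E₂
  -- `x := H²(bridge_E) c` dies in `H²(Gal(E/F₀), J_{E,S₀})` (`bridge ≫ ι = sUnitsToIdeleS`)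
  have hfac : groupCohomology.map (MonoidHom.id _) (IdeleCohomology.sUnitsToIdeleS (K := K) (F := F₀) (E := E) S S₀ hSF) 2 =
      groupCohomology.map (MonoidHom.id (E ≃ₐ[F₀] E)) (A := SUnits.sUnitsRep K S F₀ E)
          (B := IdeleCohomology.sUnitsIdeleRep F₀ E S₀) (IdeleCohomology.sUnitsBridge (K := K) (F := F₀) (E := E) S S₀ hSF) 2 ≫
        groupCohomology.map (MonoidHom.id (E ≃ₐ[F₀] E)) (A := IdeleCohomology.sUnitsIdeleRep F₀ E S₀)
          (B := IdeleCohomology.ideleSRep F₀ E S₀) (IdeleCohomology.sUnitsIdeleι S₀) 2 := by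
    rw [← groupCohomology.map_id_comp, IdeleCohomology.sUnitsBridge_comp_ι]
  have hx : groupCohomology.map (MonoidHom.id (E ≃ₐ[F₀] E)) (A := IdeleCohomology.sUnitsIdeleRep F₀ E S₀)
        (B := IdeleCohomology.ideleSRep F₀ E S₀) (IdeleCohomology.sUnitsIdeleι S₀) 2
      (groupCohomology.map (MonoidHom.id (E ≃ₐ[F₀] E)) (A := SUnits.sUnitsRep K S F₀ E)
        (B := IdeleCohomology.sUnitsIdeleRep F₀ E S₀) (IdeleCohomology.sUnitsBridge (K := K) (F := F₀) (E := E) S S₀ hSF) 2 c) =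
      0 := by
    have hc' := hc
    rw [hfac] at hc'
    exact hc'
  -- `Inf_{E→E₂} x = 0` (§1, capitulation in `E₂`)
  have h0 := IdeleCohomology.sUnitsIdeleInf_two_eq_zero_of_map_eq_zero (F := F₀) (E := E) (E' := E₂) S₀ hcap _ hx
  -- the bridge square `Hⁿ(bridge_{E₂}) (Inf c) = Inf_{E→E₂} (Hⁿ(bridge_E) c)`
  have sq := congrArg (fun φ => φ c)
    (IdeleCohomology.sUnitsRepInf_comp_map_sUnitsBridge (K := K) (F := F₀) (E := E) (E' := E₂) S S₀ hSF 2)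
  simp only [ModuleCat.hom_comp, LinearMap.coe_comp, Function.comp_apply] at sq
  -- `H²(bridge_{E₂})` is injective
  refine SUnits.Layers.map_sUnitsBridge_injective (K := K) (F := F₀) (E := E₂) S S₀ hSF 2 ?_
  rw [map_zero]
  calc groupCohomology.map (MonoidHom.id (E₂ ≃ₐ[F₀] E₂)) (A := SUnits.sUnitsRep K S F₀ E₂)
          (B := IdeleCohomology.sUnitsIdeleRep F₀ E₂ S₀) (IdeleCohomology.sUnitsBridge (K := K) (F := F₀) (E := E₂) S S₀ hSF) 2
          (SUnits.Layers.layerInf S hF h₂ 2 c)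
      = groupCohomology.map (MonoidHom.id (E₂ ≃ₐ[F₀] E₂)) (A := SUnits.sUnitsRep K S F₀ E₂)
          (B := IdeleCohomology.sUnitsIdeleRep F₀ E₂ S₀) (IdeleCohomology.sUnitsBridge (K := K) (F := F₀) (E := E₂) S S₀ hSF) 2
          (IdeleCohomology.sUnitsRepInf (K := K) (F := F₀) (E := E) (E' := E₂) S 2 c) := rfl
    _ = IdeleCohomology.sUnitsIdeleInf F₀ E E₂ S₀ 2
          (groupCohomology.map (MonoidHom.id (E ≃ₐ[F₀] E)) (A := SUnits.sUnitsRep K S F₀ E)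
            (B := IdeleCohomology.sUnitsIdeleRep F₀ E S₀) (IdeleCohomology.sUnitsBridge (K := K) (F := F₀) (E := E) S S₀ hSF) 2 c) :=
        sq
    _ = 0 := h0

end Literature.NumberTheory.GaloisRepresentations

end
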